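import Literature.NumberTheory.EllipticCurves.TianYuanZhang2017.UPlusOfGenusPointData
import Summits.BirchSwinnertonDyer.Rank1Residual.P2.CongruentNumberLevelTwoDoor
import HarnessLib

/-!
# WORKFILE (crux stmt-BirchSwinnertonDyer-20509 `PrintCf2.RamifiedOffTYZOfFacts`, line `offtyz-v7` / skeleton v8, LEAD cruxlead-20509 g1)
# — THE LEVEL-TWO LAW ON THE WHOLE ODD `k = 2` SECTOR OF CATEGORY D, IN GENUS CURRENCY: two CONJECTURAL statements
# (census-backed, NOT theorems, NOT Literature facts) and the proved composition «both ⟹ C⁺ on the sector»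
# (supersedes the R1-only workfile `Lines/offtyz_v7_LevelTwoR1Sketch.lean` of LEAD g0; same status, same rules)

Status: CONJECTURES typed for the ideator / critic / disprover / next lead; `def … : Prop` only because this is a crux
WORKFILE (`Cruxes/RamifiedOffTYZOfFacts/Lines/`), never a Theorems/Literature proposal. Nothing here is asserted.

## The sector
Category D of the congruent-number residual (square-free `n ≡ 5, 6, 7 (mod 8)`, Heath-Brown excess `s(n) = 3`, i.e.
`#Sel₂(E_n) = 2⁵`) with `n` ODD and `k = 2` prime factors consists of EXACTLY two Legendre types (Monsky's matrix, odd case,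
`k = 2`: the types `(3,5)`, `(3,7) (mod 8)` have `s = 1` identically; checked by hand in LEAD g1 NOTES):
* R1: `n = l·m`, `l ≡ 1`, `m ≡ 5 (mod 8)` (`n ≡ 5`; `s = 3` iff `(l/m) = +1`) — census 876 members `n ≤ 10⁵`, 78 B;
* R2: `n = l·m`, `l ≡ 1`, `m ≡ 7 (mod 8)` (`n ≡ 7`; `s = 3` iff `(l/m) = +1`) — census 692 members, 56 B.
(B = the Cassels–Tate pairing on `Sel₂(E_n)/E_n[2] ≅ 𝔽₂³` is ZERO: rank 3 or `Ш[4] ≠ Ш[2]`; G = «jump one»: the pairing has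
rank 2, `#Sel₄(E_n) = 2⁶`, `Ш(E_n)[2^∞] = Ш[2] ≅ (ℤ/2)²` — the class of C⁺.)  The `s = 3` condition is CARRIED BY THE SELMER
HYPOTHESIS below, so the sector predicate fixes only the prime shape.

## The uniform odd law (LEAD g0 instrument v2, evidence #38 on 20509; census kit j299242 of planner g6, HOME
`bsd-print-cf2-plan/Ideas/census-1e5/ANALYSIS.md` R1/R2):  on R1 ∪ R2 (1568 members, 134 B, **0 exceptions**)
    B ⟺ 4 ∣ g(l) ∧ 4 ∣ g(lm) ∧ 2^a ∣ #Cl(ℚ(√(lm)))[2^∞],   a = 2 on R1 (`m ≡ 5`), a = 3 on R2 (`m ≡ 7`),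
where `g(d) = #2Cl(ℚ(√−d))` are Tian–Yuan–Zhang's genus class numbers (`gK`) — read MODULO 4 — and the third bit is the
2-class DEPTH of the ORDINARY class group of the REAL quadratic field `ℚ(√n) ⊂ K_n(i)` (on this sector its 2-part is cyclic, so
«`2^a` divides the class number» is the same bit).  Dictionary with planner g6's quartic-symbol form: `4 ∣ g(l) ⟺ (2/l)₄(l/2)₄ = +1`
(Barrucand–Cohn), `4 ∣ g(lm) ⟺ (m/l)₄ = +1`; on R1 the real bit `4 ∣ h(lm)` ⟺ `(l/m)₄ = +1` given the first two (Scholz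
reciprocity `(l/m)₄(m/l)₄ = (ε_m/l)`); on R2 the real bit `8 ∣ h(lm)` is NOT a function of quartic symbols + imaginary class
groups (81 false positives without it, ANALYSIS.md R2).  No octic symbol enters.

## What is conjectured here, and what it is worth
* `LevelTwoJumpLawOdd` (SUPPORT-grade): the G/B boundary = the deep predicate.  A second-2-descent statement (Cassels 1998
  pairing on `Sel₂(E_{lm})` computed by Gauss genus theory), provable on paper by the method IN PRINT for the rank-ZERO residue
  class `n ≡ 1 (mod 8)` ([galaxy:pdf:-2884733815236964660] Wang–Zhang 2022 Thm 1.1 = Thms 4.2/4.4: «rank 0 ∧ Ш[2^∞] ≅ (ℤ/2)² ⟺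
  h₄(n) = 1 ∧ h₈-condition», via [Cas98]; Wang 2016 Sci. China Math. 59 for the congruent curve itself) and structurally by
  Smith's governing fields ([corpus:paper:arxiv-1607.07860 Prop 3.3]: the pairing on `W_SD(E,p)` is an Artin symbol); NOT in
  print for root number −1 (`n ≡ 5, 7`), presearch LEAD g1 2026-08-28.  Not provable in the kernel today (no Cassels–Tate
  pairing on `Sel₂` of an explicit curve in Mathlib/Literature).
* `LevelTwoGenusFormulaOdd` (CRUX-grade, BEYOND PRINT): on the sector ∩ {r_an = 1}, `2 ∥ 𝓛(lm)` ⟺ NOT deep, and (given `2 ∣ 𝓛`)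
  `4 ∣ 𝓛(lm)` ⟺ deep.  This is the rank-ONE level-2 analogue of Zhao's second-lowest-2-power criterion; Tian–Yuan–Zhang's
  genus-period induction (Thm 1.2 / Thm 3.5 / Prop 3.4) decides `𝓛 mod 2` only and is SILENT here (both genus sums are even on
  all of category D, g0 instrument).  Its two-line content for a would-be level-2 display of `P(lm)`: the recursion on the sector is
  `P(lm) = Z(lm) − ε·𝓛(l)·Z(m)` (`recursionIndex (lm) = {m}`); bit 1 is «`4 ∣ 𝓛(l)`» (Zhao 2001, rank 0, k = 1, IN PRINT: `4 ∣ 𝓛(l)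
  ⟺ 4 ∣ g(l)`), bit 2 is the number `g(lm) = #2Cl` of conjugates in the trace `Z(lm)` read mod 4, bit 3 is a datum of `K_n(i) ⊃ ℚ(√n)`
  that no imaginary genus field sees — so the display must live over the 4-layer of the ring class tower of `K_n(i)`, not of `K_n`.
* Together they give C⁺ = `stub_offTYZ_levelTwoScriptLExact` on the sector (`levelTwoScriptLExact_onOddTwo_of`, real proof, pure
  logic) — i.e. on 1568/2417 = 64.9 % of category D (k ≤ 2, n ≤ 10⁵); the even sector `n = 2lm` has PER-TYPE laws only
  (ANALYSIS.md Addendum, 0 exceptions / 849, no uniform ≤ 4-literal law among 129 predicates) and is not typed here; k ≥ 3 is open.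
BSD is not proved by any of this; no class is closed by this file.
-/

noncomputable section

open scoped Classical

open WeierstrassCurve Literature.NumberTheory.EllipticCurves Literature.NumberTheory.EllipticCurves.Rank1Residual
  Literature.NumberTheory.EllipticCurves.TianYuanZhang2017 Literature.NumberTheory.EllipticCurves.TianYuanZhang2017.W2
  Literature.NumberTheory.EllipticCurves.Tian2014 Summit.BirchSwinnertonDyer.Rank1Residual

set_option autoImplicit false

namespace Summit.BirchSwinnertonDyer.PrintCf2.LevelTwo.Sketch

/-- The odd `k = 2` sector of category D (prime shape only; `s = 3` is carried by the Selmer hypothesis of each statement):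
`n = l·m` with `l ≡ 1 (mod 8)` and `m ≡ 5` (R1) or `m ≡ 7 (mod 8)` (R2) primes. -/
def OddTwoSector (l m : ℕ) : Prop :=
  l.Prime ∧ m.Prime ∧ l % 8 = 1 ∧ (m % 8 = 5 ∨ m % 8 = 7)

/-- The depth exponent of the uniform law: `a = 2` on R1 (`m ≡ 5`), `a = 3` on R2 (`m ≡ 7`). -/
def depthExp (m : ℕ) : ℕ :=
  if m % 8 = 5 then 2 else 3

/-- The REAL bit: `2^a` divides the class number of the real quadratic field `ℚ(√(lm))`, read in ANY number field `K` of degree 2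
in which `lm` is a square (`Tian2014.IsQuadraticFieldOfSqrt`; all such `K` are copies of `ℚ(√(lm))` for `lm` square-free `> 1`). -/
def RealDepth (l m : ℕ) : Prop :=
  ∀ (K : Type) [Field K] [NumberField K], IsQuadraticFieldOfSqrt K ((l * m : ℕ) : ℤ) →
    2 ^ depthExp m ∣ Nat.card (ClassGroup (NumberField.RingOfIntegers K))

/-- **The deep predicate of the uniform odd law**: `4 ∣ g(l)`, `4 ∣ g(lm)` (`g = gK = #2Cl(ℚ(√−d))`, TYZ's genus class numbers
read in `GenusField`) and the real 2-class depth bit. Census: B ⟺ deep, 1568/1568. -/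
def OddTwoDeep (l m : ℕ) : Prop :=
  4 ∣ gK l ∧ 4 ∣ gK (l * m) ∧ RealDepth l m

/-- **CONJECTURE (jump law, support-grade; census 1568/1568):** on the odd `k = 2` sector with `s = 3`, the Cassels–Tate jump-one
condition `#Sel₄(E_{lm}) = 2⁶` holds iff NOT `OddTwoDeep l m`. A second-2-descent statement (no L-function). -/
def LevelTwoJumpLawOdd : Prop :=
  ∀ (l m : ℕ), OddTwoSector l m →
    Nat.card ((congruentNumberCurve (l * m)).selmerGroup 2) = 2 ^ 5 →
    (Nat.card ((congruentNumberCurve (l * m)).selmerGroup 4) = 2 ^ 6 ↔ ¬ OddTwoDeep l m)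

/-- **CONJECTURE (level-two genus FORMULA for `𝓛`, crux-grade, BEYOND PRINT):** on the odd `k = 2` sector with `s = 3` and
`ord_{s=1} L(E_{lm}, s) = 1`, every integer `L` with `𝓛(lm)² = L²` satisfies `2 ∥ L` iff NOT `OddTwoDeep l m`. -/
def LevelTwoGenusFormulaOdd : Prop :=
  ∀ (l m : ℕ) [(congruentNumberCurve (l * m)).IsElliptic], OddTwoSector l m →
    (congruentNumberCurve (l * m)).analyticRank = 1 →
    Nat.card ((congruentNumberCurve (l * m)).selmerGroup 2) = 2 ^ 5 →
    ∀ L : ℤ, IsScriptL (l * m) L → (((2 : ℤ) ∣ L ∧ ¬ (4 : ℤ) ∣ L) ↔ ¬ OddTwoDeep l m)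

/-- **C⁺ RESTRICTED to the odd `k = 2` sector** — `stub_offTYZ_levelTwoScriptLExact` with `n = l·m` on `OddTwoSector`
(the `n % 8` and square-free hypotheses of C⁺ are consequences of the sector and are dropped). -/
def LevelTwoScriptLExactOddTwo : Prop :=
  ∀ (l m : ℕ) [(congruentNumberCurve (l * m)).IsElliptic], OddTwoSector l m →
    (congruentNumberCurve (l * m)).analyticRank = 1 →
    Nat.card ((congruentNumberCurve (l * m)).selmerGroup 2) = 2 ^ 5 →
    Nat.card ((congruentNumberCurve (l * m)).selmerGroup 4) = 2 ^ 6 →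
    ∀ L : ℤ, IsScriptL (l * m) L → (2 : ℤ) ∣ L ∧ ¬ (4 : ℤ) ∣ L

/-- **The two conjectures give C⁺ on the odd `k = 2` sector** — real proof, pure logic: the jump law turns `#Sel₄ = 2⁶` into
`¬ deep`, the genus formula turns `¬ deep` into `2 ∥ 𝓛`. -/
theorem levelTwoScriptLExact_onOddTwo_of (hJ : LevelTwoJumpLawOdd) (hF : LevelTwoGenusFormulaOdd) :
    LevelTwoScriptLExactOddTwo := by
  intro l m _ hS hr hS₂ hS₄ L hL
  exact (hF l m hS hr hS₂ L hL).mpr ((hJ l m hS hS₂).mp hS₄)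

/-- **Conversely the genus formula predicts `4 ∣ 𝓛(lm)` exactly on the deep (= B, non-jump) members of the rank-one sector**
(census: Ш_an = 16 on 14/14 computed B members of rank one, kit j300539). -/
theorem four_dvd_scriptL_onOddTwo_of (hF : LevelTwoGenusFormulaOdd)
    (l m : ℕ) [(congruentNumberCurve (l * m)).IsElliptic] (hS : OddTwoSector l m)
    (hr : (congruentNumberCurve (l * m)).analyticRank = 1)
    (hS₂ : Nat.card ((congruentNumberCurve (l * m)).selmerGroup 2) = 2 ^ 5)
    (hdeep : OddTwoDeep l m) (L : ℤ) (hL : IsScriptL (l * m) L) (h2 : (2 : ℤ) ∣ L) : (4 : ℤ) ∣ L := by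
  by_contra h4
  exact ((hF l m hS hr hS₂ L hL).mp ⟨h2, h4⟩) hdeep

/-- **And the jump law alone says where C⁺'s class sits inside the sector**: under it, a sector member with `s = 3` is in the
jump-one class iff it is not deep — so C⁺ on the sector is EQUIVALENT to «`2 ∥ 𝓛` on the non-deep rank-one members», and the
genus formula is C⁺-on-the-sector plus its B-side companion `four_dvd_scriptL_onOddTwo_of`. -/
theorem levelTwoGenusFormulaOdd_of (hJ : LevelTwoJumpLawOdd) (hC : LevelTwoScriptLExactOddTwo)
    (hB : ∀ (l m : ℕ) [(congruentNumberCurve (l * m)).IsElliptic], OddTwoSector l m →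
      (congruentNumberCurve (l * m)).analyticRank = 1 →
      Nat.card ((congruentNumberCurve (l * m)).selmerGroup 2) = 2 ^ 5 →
      OddTwoDeep l m → ∀ L : ℤ, IsScriptL (l * m) L → ¬ ((2 : ℤ) ∣ L ∧ ¬ (4 : ℤ) ∣ L)) :
    LevelTwoGenusFormulaOdd := by
  intro l m _ hS hr hS₂ L hL
  constructor
  · intro h2 hdeep
    exact hB l m hS hr hS₂ hdeep L hL h2
  · intro hnd
    exact hC l m hS hr hS₂ ((hJ l m hS hS₂).mpr hnd) L hL

/-- The sector lies in C⁺'s residue classes: `l·m ≡ 5` or `7 (mod 8)`. -/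
theorem OddTwoSector.mod_eight {l m : ℕ} (h : OddTwoSector l m) : l * m % 8 = 5 ∨ l * m % 8 = 7 := by
  obtain ⟨-, -, hl, hm⟩ := h
  rw [Nat.mul_mod, hl]
  rcases hm with hm | hm <;> simp [hm]

/-- The sector consists of square-free `n = l·m` (two distinct primes: `l ≡ 1`, `m ≢ 1 (mod 8)`). -/
theorem OddTwoSector.squarefree {l m : ℕ} (h : OddTwoSector l m) : Squarefree (l * m) := by
  obtain ⟨hl, hm, hl8, hm8⟩ := h
  have hne : l ≠ m := by rintro rfl; omega
  exact Nat.squarefree_mul_iff.mpr ⟨(Nat.coprime_primes hl hm).mpr hne, hl.prime.squarefree, hm.prime.squarefree⟩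

/-- **C⁺ (VERBATIM, as registered) implies its restriction to the odd `k = 2` sector.** -/
theorem levelTwoScriptLExactOddTwo_of_levelTwoScriptLExact
    (hC : ∀ (n : ℕ) [(congruentNumberCurve n).IsElliptic] [(congruentNumberCurve n).IsGloballyMinimal],
      Squarefree n → (n % 8 = 5 ∨ n % 8 = 6 ∨ n % 8 = 7) →
      (congruentNumberCurve n).analyticRank = 1 →
      Nat.card ((congruentNumberCurve n).selmerGroup 2) = 2 ^ 5 →
      Nat.card ((congruentNumberCurve n).selmerGroup 4) = 2 ^ 6 →
      ∀ L : ℤ, IsScriptL n L → (2 : ℤ) ∣ L ∧ ¬ (4 : ℤ) ∣ L) :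
    LevelTwoScriptLExactOddTwo := by
  intro l m _ hS hr hS₂ hS₄ L hL
  have hsq := hS.squarefree
  haveI := isGloballyMinimal_congruentNumberCurve hsq
  have h8 : l * m % 8 = 5 ∨ l * m % 8 = 6 ∨ l * m % 8 = 7 := by
    rcases hS.mod_eight with h | h
    · exact Or.inl h
    · exact Or.inr (Or.inr h)
  exact hC (l * m) hsq h8 hr hS₂ hS₄ L hL

end Summit.BirchSwinnertonDyer.PrintCf2.LevelTwo.Sketch

end
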